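import Literature.NumberTheory.LFunctions.RayClassCharacter
import HarnessLib

/-!
# The L-series of a character `mod 𝔪` with POLYNOMIAL GROWTH: absolute convergence and Euler product (Neukirch VII (8.1) for Größencharaktere)

Topic `NumberTheory/LFunctions`; companion of `RayClassCharacter.lean` (THEOREMS ONLY). There the Euler product (8.1)
`L(χ, s) = ∑_{(𝔞,𝔪)=1} χ(𝔞) 𝔑𝔞^{-s} = ∏_{𝔭∤𝔪} (1 − χ(𝔭) 𝔑𝔭^{-s})⁻¹` is proved for `re s > 1` under `|ψ(𝔭)| ≤ 1` (characters of FINITE order). For a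
Größencharakter of weight `w` (e.g. type `(1,0)`: `|ψ(𝔭)| = 𝔑𝔭^{1/2}`), or any prime function with `|ψ(𝔭)| ≤ |𝔑𝔭^{t}|`, the same holds for `re(s − t) > 1`:
`|χ(𝔞)| ≤ |𝔑𝔞^{t}|` by multiplicativity (`norm_idealPow_le_norm_cpow`), so the series is dominated by `ζ_K(re(s − t))` (`summable_norm_rayClassCoeff_mul_of_growth`), and the
Euler product argument of `RayClassCharacter.lean` goes through verbatim from SUMMABILITY alone (`hasProd_rayClassLSeries_of_summable`, `rayClassLSeries_eq_tprod_of_growth`).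
Consumer: crux L of `Summits/BirchSwinnertonDyer` (line `rtt_w3`, stub S4″, brick A-5: the identity `L(g^{e∘ι} ⊗ χ̄, s) = L_K(θ^e·(χ̄∘N), s)` as Euler products).
Reference: J. Neukirch, *Algebraic Number Theory*, Ch. VII §8 (8.1) Proposition (the proof only uses absolute convergence). [NeukirchANT1999]
-/

noncomputable section

open Filter Topology IsDedekindDomain IsDedekindDomain.HeightOneSpectrum NumberField Finset
open scoped nonZeroDivisors

namespace Literature.NumberTheory.LFunctions

variable {K : Type*} [Field K] [NumberField K]

/-- **Multiplicative growth bound**: if `|ψ(𝔭)| ≤ |𝔑𝔭^{t}|` at every prime `𝔭 ∣ 𝔞` then `|χ(𝔞)| = |∏ ψ(𝔭)^{ν_𝔭(𝔞)}| ≤ |𝔑𝔞^{t}|` (`𝔞 ≠ 0`; `t ≠ 0`).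
[cite: NeukirchANT1999, Ch. VII §8 (8.1) Proposition] -/
theorem norm_idealPow_le_norm_cpow (ψ : HeightOneSpectrum (𝓞 K) → ℂ) {t : ℂ} (ht : t ≠ 0) {I : Ideal (𝓞 K)} (hI : I ≠ ⊥)
    (h : ∀ v : HeightOneSpectrum (𝓞 K), I ≤ v.asIdeal → ‖ψ v‖ ≤ ‖((Ideal.absNorm v.asIdeal : ℕ) : ℂ) ^ t‖) :
    ‖idealPow K ψ I‖ ≤ ‖((Ideal.absNorm I : ℕ) : ℂ) ^ t‖ := by
  classical
  obtain ⟨g, rfl⟩ := exists_finsuppProd_asIdeal_pow_eq hI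
  have hneg : -(-t) = t := neg_neg t
  have hkey := absNorm_finsuppProd_cpow K (neg_ne_zero.mpr ht) g
  rw [hneg] at hkey
  rw [idealPow_finsuppProd, hkey, Finsupp.prod, Finsupp.prod, Complex.norm_prod, Complex.norm_prod]
  refine Finset.prod_le_prod (fun _ _ ↦ norm_nonneg _) fun v hv ↦ ?_
  rw [norm_pow, norm_pow]
  refine pow_le_pow_left₀ (norm_nonneg _) (h v ?_) _
  have hdvd : v.asIdeal ∣ g.prod fun v k => v.asIdeal ^ k := by
    rw [Finsupp.prod]
    exact (dvd_pow_self _ (Finsupp.mem_support_iff.mp hv)).trans (Finset.dvd_prod_of_mem _ hv)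
  exact Ideal.le_of_dvd hdvd

/-- `|χ(𝔞) 𝔑𝔞^{-s}| ≤ |𝔑𝔞^{-(s−t)}|` under the growth bound off `𝔪` (`𝔪 ≠ 0`, `t ≠ 0`). [cite: NeukirchANT1999, Ch. VII §8 (8.1) Proposition] -/
theorem norm_rayClassCoeff_mul_le_of_growth {𝔪 : Ideal (𝓞 K)} (h𝔪 : 𝔪 ≠ ⊥) {ψ : HeightOneSpectrum (𝓞 K) → ℂ} {t : ℂ} (ht : t ≠ 0)
    (hψ : ∀ v : HeightOneSpectrum (𝓞 K), ¬ 𝔪 ≤ v.asIdeal → ‖ψ v‖ ≤ ‖((Ideal.absNorm v.asIdeal : ℕ) : ℂ) ^ t‖) (s : ℂ) (I : Ideal (𝓞 K)) :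
    ‖rayClassCoeff 𝔪 ψ I * ((Ideal.absNorm I : ℕ) : ℂ) ^ (-s)‖ ≤ ‖((Ideal.absNorm I : ℕ) : ℂ) ^ (-(s - t))‖ := by
  unfold rayClassCoeff
  split_ifs with hc
  · have hN : ((Ideal.absNorm I : ℕ) : ℂ) ≠ 0 := by
      exact_mod_cast (Ideal.absNorm_eq_zero_iff.not.mpr hc.1)
    rw [norm_mul, show -(s - t) = t + -s by ring, Complex.cpow_add _ _ hN, norm_mul]
    refine mul_le_mul_of_nonneg_right ?_ (norm_nonneg _)
    refine norm_idealPow_le_norm_cpow ψ ht hc.1 fun v hv ↦ hψ v fun hm ↦ ?_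
    exact (isCoprime_iff_forall_not_le h𝔪).mp hc.2 v hm hv
  · rw [zero_mul, norm_zero]; exact norm_nonneg _

/-- **Absolute convergence for `re(s − t) > 1`** under `|ψ(𝔭)| ≤ |𝔑𝔭^{t}|` off `𝔪` — comparison with `ζ_K` (`summable_norm_absNorm_cpow`).
[cite: NeukirchANT1999, Ch. VII §8 (8.1) Proposition] -/
theorem summable_norm_rayClassCoeff_mul_of_growth {𝔪 : Ideal (𝓞 K)} (h𝔪 : 𝔪 ≠ ⊥) {ψ : HeightOneSpectrum (𝓞 K) → ℂ} {t : ℂ} (ht : t ≠ 0)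
    (hψ : ∀ v : HeightOneSpectrum (𝓞 K), ¬ 𝔪 ≤ v.asIdeal → ‖ψ v‖ ≤ ‖((Ideal.absNorm v.asIdeal : ℕ) : ℂ) ^ t‖) {s : ℂ} (hs : 1 < (s - t).re) :
    Summable fun I : Ideal (𝓞 K) => ‖rayClassCoeff 𝔪 ψ I * ((Ideal.absNorm I : ℕ) : ℂ) ^ (-s)‖ :=
  (summable_norm_absNorm_cpow K hs).of_nonneg_of_le (fun _ => norm_nonneg _) (norm_rayClassCoeff_mul_le_of_growth h𝔪 ht hψ s)

/-- `L(χ, s)` is the sum of its series wherever the series converges absolutely. [cite: NeukirchANT1999, Ch. VII §8 (8.1) Proposition] -/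
theorem hasSum_rayClassLSeries_of_summable {𝔪 : Ideal (𝓞 K)} {ψ : HeightOneSpectrum (𝓞 K) → ℂ} {s : ℂ}
    (hsum : Summable fun I : Ideal (𝓞 K) => ‖rayClassCoeff 𝔪 ψ I * ((Ideal.absNorm I : ℕ) : ℂ) ^ (-s)‖) :
    HasSum (fun I : Ideal (𝓞 K) => rayClassCoeff 𝔪 ψ I * ((Ideal.absNorm I : ℕ) : ℂ) ^ (-s)) (rayClassLSeries 𝔪 ψ s) :=
  hsum.of_norm.hasSum

/-- **Euler product over all primes from absolute convergence alone** (the proof of `hasProd_rayClassLSeries_rayClassPrimeValue` verbatim, with the summability as a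
hypothesis; `s ≠ 0`). [cite: NeukirchANT1999, Ch. VII §8 (8.1) Proposition] -/
theorem hasProd_rayClassLSeries_rayClassPrimeValue_of_summable {𝔪 : Ideal (𝓞 K)} (h𝔪 : 𝔪 ≠ ⊥) {ψ : HeightOneSpectrum (𝓞 K) → ℂ} {s : ℂ} (hs0 : s ≠ 0)
    (hsum : Summable fun I : Ideal (𝓞 K) => ‖rayClassCoeff 𝔪 ψ I * ((Ideal.absNorm I : ℕ) : ℂ) ^ (-s)‖) :
    HasProd (fun v : HeightOneSpectrum (𝓞 K) => (1 - rayClassPrimeValue 𝔪 ψ v * ((Ideal.absNorm v.asIdeal : ℕ) : ℂ) ^ (-s))⁻¹) (rayClassLSeries 𝔪 ψ s) := by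
  have hkey := absNorm_finsuppProd_cpow K hs0
  have hinj := finsuppProd_asIdeal_pow_injective (R := 𝓞 K)
  set x : HeightOneSpectrum (𝓞 K) → ℂ := fun v => rayClassPrimeValue 𝔪 ψ v * ((Ideal.absNorm v.asIdeal : ℕ) : ℂ) ^ (-s) with hx
  have hprod : ∀ g : HeightOneSpectrum (𝓞 K) →₀ ℕ, (g.prod fun v k => x v ^ k) =
      rayClassCoeff 𝔪 ψ (g.prod fun v k => v.asIdeal ^ k) * ((Ideal.absNorm (g.prod fun v k => v.asIdeal ^ k) : ℕ) : ℂ) ^ (-s) := by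
    intro g
    rw [hkey, ← finsuppProd_rayClassPrimeValue h𝔪 ψ g, Finsupp.prod, Finsupp.prod, Finsupp.prod, ← Finset.prod_mul_distrib]
    exact Finset.prod_congr rfl fun v _ => by rw [hx, mul_pow]
  have hsumg : Summable fun g : HeightOneSpectrum (𝓞 K) →₀ ℕ => ‖g.prod fun v k => x v ^ k‖ := by
    simp only [hprod]
    exact hsum.comp_injective hinj
  have hP := FinsuppEulerProduct.hasProd_inv_one_sub hsumg
  have htsum : (∑' g : HeightOneSpectrum (𝓞 K) →₀ ℕ, g.prod fun v k => x v ^ k) = rayClassLSeries 𝔪 ψ s := by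
    simp only [hprod]
    rw [hinj.tsum_eq (f := fun I : Ideal (𝓞 K) => rayClassCoeff 𝔪 ψ I * ((Ideal.absNorm I : ℕ) : ℂ) ^ (-s)) ?_]
    · rfl
    · intro I hI
      refine mem_range_finsuppProd_asIdeal_pow_iff.mpr fun h => ?_
      rw [Function.mem_support, h, Submodule.zero_eq_bot, rayClassCoeff_bot, zero_mul] at hI
      exact hI rfl
  rw [htsum] at hP
  exact hP

/-- **Euler product over the primes `𝔭 ∤ 𝔪` from absolute convergence** (`HasProd` over the subtype). [cite: NeukirchANT1999, Ch. VII §8 (8.1) Proposition] -/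
theorem hasProd_rayClassLSeries_of_summable {𝔪 : Ideal (𝓞 K)} (h𝔪 : 𝔪 ≠ ⊥) {ψ : HeightOneSpectrum (𝓞 K) → ℂ} {s : ℂ} (hs0 : s ≠ 0)
    (hsum : Summable fun I : Ideal (𝓞 K) => ‖rayClassCoeff 𝔪 ψ I * ((Ideal.absNorm I : ℕ) : ℂ) ^ (-s)‖) :
    HasProd (fun v : {v : HeightOneSpectrum (𝓞 K) // ¬ 𝔪 ≤ v.asIdeal} => (1 - ψ v.1 * ((Ideal.absNorm v.1.asIdeal : ℕ) : ℂ) ^ (-s))⁻¹) (rayClassLSeries 𝔪 ψ s) := by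
  classical
  have h := hasProd_rayClassLSeries_rayClassPrimeValue_of_summable h𝔪 hs0 hsum
  rw [← hasProd_subtype_iff_of_mulSupport_subset (s := {v : HeightOneSpectrum (𝓞 K) | ¬ 𝔪 ≤ v.asIdeal}) ?_] at h
  · refine h.congr_fun ?_
    rintro ⟨v, hv⟩
    simp only [Function.comp_apply, rayClassPrimeValue, Set.mem_setOf_eq] at hv ⊢
    rw [if_neg hv]
  · intro v hv
    simp only [Function.mem_mulSupport, Set.mem_setOf_eq] at hv ⊢
    intro hm
    apply hv
    rw [rayClassPrimeValue, if_pos hm, zero_mul, sub_zero, inv_one]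

/-- **Euler product (8.1) for a character of polynomial growth**: if `|ψ(𝔭)| ≤ |𝔑𝔭^{t}|` off `𝔪` (`t ≠ 0`) and `re(s − t) > 1`, then
`L(χ, s) = ∏'_{𝔭 ∤ 𝔪} (1 − ψ(𝔭) 𝔑𝔭^{-s})⁻¹`. [cite: NeukirchANT1999, Ch. VII §8 (8.1) Proposition] -/
theorem rayClassLSeries_eq_tprod_of_growth {𝔪 : Ideal (𝓞 K)} (h𝔪 : 𝔪 ≠ ⊥) {ψ : HeightOneSpectrum (𝓞 K) → ℂ} {t : ℂ} (ht : t ≠ 0)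
    (hψ : ∀ v : HeightOneSpectrum (𝓞 K), ¬ 𝔪 ≤ v.asIdeal → ‖ψ v‖ ≤ ‖((Ideal.absNorm v.asIdeal : ℕ) : ℂ) ^ t‖) {s : ℂ} (hs : 1 < (s - t).re) (hs0 : s ≠ 0) :
    rayClassLSeries 𝔪 ψ s = ∏' v : {v : HeightOneSpectrum (𝓞 K) // ¬ 𝔪 ≤ v.asIdeal}, (1 - ψ v.1 * ((Ideal.absNorm v.1.asIdeal : ℕ) : ℂ) ^ (-s))⁻¹ :=
  (hasProd_rayClassLSeries_of_summable h𝔪 hs0 (summable_norm_rayClassCoeff_mul_of_growth h𝔪 ht hψ hs)).tprod_eq.symm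

end Literature.NumberTheory.LFunctions

end
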